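import Literature.NumberTheory.QuadraticForms.LandherrHermitianMatricesDiagonalize
import Literature.NumberTheory.QuadraticForms.LandherrHermitianRankN
import Mathlib.Analysis.Matrix.Spectrum
import HarnessLib

/-!
# Landherr's theorem for hermitian matrices of arbitrary rank over a CM field

Topic `NumberTheory/QuadraticForms`. Let `L` be a CM field with complex conjugation `σ`, `L⁺` its maximal
real subfield, `N(z) = z · σ z`. **Landherr's theorem** (Landherr 1936; Shimura, *Arithmetic of hermitian
forms*, Doc. Math. 13 (2008) Thm. 2.2 (i), p. 748: "the isomorphism class of `(V, φ)` is determined by `n`,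
`{σ_v}` and `d₀(φ)`"): two non-degenerate `σ`-hermitian matrices `H, H'` of the same size over `L` are
congruent over `L` (`H' = ᵗ(σg) · H · g`, `g ∈ GL(L)`) iff at every complex embedding `τ` the complex
hermitian matrices `τ(H)`, `τ(H')` have the same number of positive eigenvalues and `det H = det H' · N(z)`
for some `z ∈ Lˣ`.

* §B `Landherr.card_pos_eigenvalues_eq_posCount` — **Sylvester's law of inertia, eigenvalue form**: for any
  diagonalisation `ᵗσG · H · G = diag d` over `L`, the number of positive eigenvalues of `τ(H)`
  (`Matrix.IsHermitian.eigenvalues`, Mathlib's spectral theorem) is `Landherr.posCount L τ d`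
  (from `Landherr.card_pos_le_of_congr`);
* §C `hermitianMatrices_congruent_iff_invariants` — the theorem (diagonalise both sides by
  `Landherr.exists_congr_diagonal`, apply `hermitianDiagonal_isometric_iff_invariants`, and transport
  the two invariants); `hermitianMatrices_congruent_iff_invariants_fin` over `Fin n`;
  `hermitianMatrix_congruent_diagonal` — diagonalisability in `GL` form.

Provenance: `pub-hodgecm` package file `Proofs/LandherrMatrix.lean` §B–§C (gen 7), ported to Mathlib vocabulary.

## References

* W. Landherr, Abh. Math. Sem. Univ. Hamburg 11 (1936) 245–248 [Landherr1936HermitianForms].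
* G. Shimura, *Arithmetic of hermitian forms*, Doc. Math. 13 (2008) 739–774, Thm. 2.2 (i).
* P. Deligne, *Hodge cycles on abelian varieties*, LNM 900 (1982), §4 Prop. 4.1 [Deligne1982HodgeCycles].
-/

noncomputable section

open NumberField
open scoped Matrix ComplexConjugate

namespace Literature.NumberTheory.QuadraticForms

namespace Landherr

variable (L : Type) [Field L] [NumberField L] [IsCMField L]

/-! ## §B. The positive index at a complex embedding: eigenvalues of `τ(H)` vs. any diagonalisation over `L` -/

section Spectral

variable {ι : Type} [Fintype ι] [DecidableEq ι]

omit [Fintype ι] [DecidableEq ι] in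
/-- `τ(H)` is a hermitian complex matrix. [folklore] -/
theorem isHermitian_map {H : Matrix ι ι L} (hH : conjTranspose L H = H) (τ : L →+* ℂ) : (H.map τ).IsHermitian := by
  have h := congrArg (fun M : Matrix ι ι L => M.map τ) hH
  simp only [map_conjTranspose] at h
  exact h

omit [DecidableEq ι] in
/-- A congruence over `L` maps to a complex congruence `(τG)ᴴ · τH · τG = τD`. [folklore] -/
theorem congr_map_embedding {G H D : Matrix ι ι L} (e : conjTranspose L G * H * G = D) (τ : L →+* ℂ) :
    (G.map τ)ᴴ * H.map τ * G.map τ = D.map τ := by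
  have h := congrArg (fun M : Matrix ι ι L => M.map τ) e
  simp only [Matrix.map_mul, map_conjTranspose] at h
  exact h

omit [NumberField L] [IsCMField L] in
/-- Invertibility is preserved under a complex embedding. [folklore] -/
theorem isUnit_det_map_embedding {G : Matrix ι ι L} (hG : IsUnit G.det) (τ : L →+* ℂ) : IsUnit (G.map τ).det := by
  rw [← RingHom.mapMatrix_apply, ← RingHom.map_det]
  exact isUnit_iff_ne_zero.mpr ((map_ne_zero τ).mpr hG.ne_zero)

/-- `Re (r : ℂ) = r` in `RCLike` spelling. [folklore] -/
theorem re_rclike_ofReal (r : ℝ) : ((RCLike.ofReal r : ℂ)).re = r := by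
  rw [← RCLike.re_to_complex, RCLike.ofReal_re]

omit [DecidableEq ι] in
/-- Counting positive entries of a real family through `ℂ`. [folklore] -/
theorem card_pos_re_ofReal (f : ι → ℝ) :
    (Finset.univ.filter fun i => 0 < ((RCLike.ofReal ∘ f) i : ℂ).re).card =
      (Finset.univ.filter fun i => 0 < f i).card := by
  simp only [Function.comp_apply, re_rclike_ofReal]

/-- **Sylvester's law of inertia, eigenvalue form.**  If `ᵗ(σG) · H · G = diag d` over `L` with `G` invertible,
then at every complex embedding `τ` the number of positive eigenvalues of the hermitian matrix `τ(H)` equals the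
number of `i` with `τ(d i) > 0`. [cite: Landherr1936HermitianForms] -/
theorem card_pos_eigenvalues_eq_posCount {H G : Matrix ι ι L} {d : ι → L} (hH : conjTranspose L H = H) (hG : IsUnit G.det)
    (e : conjTranspose L G * H * G = Matrix.diagonal d) (τ : L →+* ℂ) :
    (Finset.univ.filter fun i => 0 < (isHermitian_map L hH τ).eigenvalues i).card = posCount L τ d := by
  set hA := isHermitian_map L hH τ with hAdef
  set A : Matrix ι ι ℂ := H.map τ with hAmat
  set U : Matrix ι ι ℂ := (hA.eigenvectorUnitary : Matrix ι ι ℂ) with hUdef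
  set D : Matrix ι ι ℂ := Matrix.diagonal (RCLike.ofReal ∘ hA.eigenvalues) with hDdef
  -- the spectral theorem: `Uᴴ A U = D`, `U Uᴴ = 1`
  have hU : Uᴴ * A * U = D := by
    have h := hA.conjStarAlgAut_star_eigenvectorUnitary
    rw [Unitary.conjStarAlgAut_star_apply, Matrix.star_eq_conjTranspose] at h
    exact h
  have hUU : U * Uᴴ = 1 := by
    have h := Unitary.coe_mul_star_self hA.eigenvectorUnitary
    rwa [Unitary.coe_star, Matrix.star_eq_conjTranspose] at h
  have hAeq : U * D * Uᴴ = A := by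
    rw [← hU]
    calc U * (Uᴴ * A * U) * Uᴴ = (U * Uᴴ) * A * (U * Uᴴ) := by simp only [Matrix.mul_assoc]
      _ = A := by rw [hUU, Matrix.one_mul, Matrix.mul_one]
  -- the `L`-diagonalisation seen at `τ`: `Gτᴴ A Gτ = diag (τ d)`, `Gτ` invertible
  set Gτ : Matrix ι ι ℂ := G.map τ with hGτdef
  have eτ : Gτᴴ * A * Gτ = Matrix.diagonal fun i => τ (d i) := by
    have h := congr_map_embedding L e τ
    rwa [Matrix.diagonal_map (map_zero τ)] at h
  have hGτ : IsUnit Gτ.det := isUnit_det_map_embedding L hG τ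
  apply le_antisymm
  · -- `#pos eigenvalues ≤ posCount`: congruence `(Gτ⁻¹ U)ᴴ · diag (τ d) · (Gτ⁻¹ U) = D`
    have hW1 : Gτ * Gτ⁻¹ = 1 := Matrix.mul_nonsing_inv Gτ hGτ
    have hWc : Gτ⁻¹ᴴ * Gτᴴ = 1 := by rw [← Matrix.conjTranspose_mul, hW1, Matrix.conjTranspose_one]
    have h2 : (Gτ⁻¹ * U)ᴴ * (Matrix.diagonal fun i => τ (d i)) * (Gτ⁻¹ * U) = D := by
      rw [← eτ, Matrix.conjTranspose_mul]
      calc Uᴴ * Gτ⁻¹ᴴ * (Gτᴴ * A * Gτ) * (Gτ⁻¹ * U) = Uᴴ * (Gτ⁻¹ᴴ * Gτᴴ) * A * (Gτ * Gτ⁻¹) * U := by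
            simp only [Matrix.mul_assoc]
        _ = D := by rw [hWc, hW1, Matrix.mul_one, Matrix.mul_one, hU]
    have h := card_pos_le_of_congr h2
    rwa [card_pos_re_ofReal] at h
  · -- `posCount ≤ #pos eigenvalues`: congruence `(Uᴴ Gτ)ᴴ · D · (Uᴴ Gτ) = diag (τ d)`
    have h1 : (Uᴴ * Gτ)ᴴ * D * (Uᴴ * Gτ) = Matrix.diagonal fun i => τ (d i) := by
      rw [Matrix.conjTranspose_mul, Matrix.conjTranspose_conjTranspose, ← eτ, ← hAeq]
      simp only [Matrix.mul_assoc]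
    have h := card_pos_le_of_congr h1
    rwa [card_pos_re_ofReal] at h

end Spectral

/-! ## §C. Landherr's theorem for hermitian matrices -/

section Main

variable {ι : Type} [Fintype ι] [DecidableEq ι]

/-- The class of `x / y` in `L₀^× / N(L^×)` does not change when `x` and `y` are multiplied by norms. [folklore] -/
theorem normClass_mul_norm_iff {x y u v : L} (hu : u ≠ 0) (hv : v ≠ 0) :
    (∃ z : L, z ≠ 0 ∧ x * (u * IsCMField.complexConj L u) = y * (v * IsCMField.complexConj L v) * (z * IsCMField.complexConj L z)) ↔
      ∃ z : L, z ≠ 0 ∧ x = y * (z * IsCMField.complexConj L z) := by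
  have hσu : IsCMField.complexConj L u ≠ 0 := (map_ne_zero _).mpr hu
  have hσv : IsCMField.complexConj L v ≠ 0 := (map_ne_zero _).mpr hv
  constructor
  · rintro ⟨z, hz, h⟩
    refine ⟨v * z / u, div_ne_zero (mul_ne_zero hv hz) hu, ?_⟩
    rw [map_div₀, map_mul]
    field_simp
    linear_combination h
  · rintro ⟨z, hz, h⟩
    refine ⟨z * u / v, div_ne_zero (mul_ne_zero hz hu) hv, ?_⟩
    rw [map_div₀, map_mul, h]
    field_simp

/-- `∏ dᵢ = det H · N(det G)` for a diagonalisation `ᵗ(σG) · H · G = diag d`. [folklore] -/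
theorem prod_eq_det_mul_norm {H G : Matrix ι ι L} {d : ι → L} (e : conjTranspose L G * H * G = Matrix.diagonal d) :
    ∏ i, d i = H.det * (G.det * IsCMField.complexConj L G.det) := by
  have h := congrArg Matrix.det e
  rw [Matrix.det_mul, Matrix.det_mul, det_conjTranspose, Matrix.det_diagonal] at h
  rw [← h]
  ring

/-- A hermitian matrix is recovered from a diagonalisation: `H = ᵗ(σG⁻¹) · diag d · G⁻¹`. [folklore] -/
theorem eq_congr_inv_diagonal {H G : Matrix ι ι L} {d : ι → L} (hG : IsUnit G.det)
    (e : conjTranspose L G * H * G = Matrix.diagonal d) : H = conjTranspose L G⁻¹ * Matrix.diagonal d * G⁻¹ := by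
  have hW : G * G⁻¹ = 1 := Matrix.mul_nonsing_inv G hG
  rw [← e]
  calc H = conjTranspose L (G * G⁻¹) * H * (G * G⁻¹) := by rw [hW, conjTranspose_one, Matrix.one_mul, Matrix.mul_one]
    _ = conjTranspose L G⁻¹ * (conjTranspose L G * H * G) * G⁻¹ := by rw [conjTranspose_mul]; simp only [Matrix.mul_assoc]

/-- Congruence of `H, H'` over `L` is isometry of any pair of diagonalisations. [folklore] -/
theorem congr_iff_isomDiag {H H' G G' : Matrix ι ι L} {d d' : ι → L} (hG : IsUnit G.det)
    (e : conjTranspose L G * H * G = Matrix.diagonal d) (hG' : IsUnit G'.det) (e' : conjTranspose L G' * H' * G' = Matrix.diagonal d') :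
    (∃ g : GL ι L, conjTranspose L (g : Matrix ι ι L) * H * (g : Matrix ι ι L) = H') ↔ IsomDiag L d d' := by
  constructor
  · rintro ⟨g, hg⟩
    refine ⟨G⁻¹ * (g : Matrix ι ι L) * G', ?_, ?_⟩
    · rw [Matrix.det_mul, Matrix.det_mul]
      exact ((Matrix.isUnit_nonsing_inv_det G hG).mul (Matrix.isUnits_det_units g)).mul hG'
    · rw [← e', ← hg, eq_congr_inv_diagonal L hG e, conjTranspose_mul, conjTranspose_mul]
      simp only [Matrix.mul_assoc]
  · rintro ⟨M, hM, hMe⟩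
    have hunit : IsUnit (G * M * G'⁻¹).det := by
      rw [Matrix.det_mul, Matrix.det_mul]
      exact (hG.mul hM).mul (Matrix.isUnit_nonsing_inv_det G' hG')
    refine ⟨Matrix.nonsingInvUnit (G * M * G'⁻¹) hunit, ?_⟩
    show conjTranspose L (G * M * G'⁻¹) * H * (G * M * G'⁻¹) = H'
    rw [eq_congr_inv_diagonal L hG' e', ← hMe, eq_congr_inv_diagonal L hG e, conjTranspose_mul, conjTranspose_mul]
    have h1 : G⁻¹ * G = 1 := Matrix.nonsing_inv_mul G hG
    have h2 : conjTranspose L G * conjTranspose L G⁻¹ = 1 := by rw [← conjTranspose_mul, h1, conjTranspose_one]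
    calc conjTranspose L G'⁻¹ * (conjTranspose L M * conjTranspose L G) * (conjTranspose L G⁻¹ * Matrix.diagonal d * G⁻¹) * (G * M * G'⁻¹)
        = conjTranspose L G'⁻¹ * (conjTranspose L M * ((conjTranspose L G * conjTranspose L G⁻¹) * Matrix.diagonal d * (G⁻¹ * G)) * M) * G'⁻¹ := by
          simp only [Matrix.mul_assoc]
      _ = conjTranspose L G'⁻¹ * (conjTranspose L M * Matrix.diagonal d * M) * G'⁻¹ := by
          rw [h2, h1, Matrix.one_mul, Matrix.mul_one]

end Main
end Landherr

/-! ## The theorem -/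

open Landherr in
/-- **Landherr's theorem for hermitian matrices of arbitrary rank over a CM field** [La36] (Shimura, Doc. Math. 13
(2008) Thm 2.2(i) p. 748).  Let `L` be a CM field with complex conjugation `σ` and `H, H'` two `σ`-hermitian
(`ᵗ(σH) = H`) matrices of the same finite size over `L` with `det H, det H' ≠ 0`.  Then `H' = ᵗ(σg) · H · g` for some
`g ∈ GL(L)` if and only if
* at every complex embedding `τ` of `L` the hermitian complex matrices `τ(H)` and `τ(H')` have the same number of
  positive eigenvalues (the signatures `σ_v` at the real places `v` of `L₀`), and
* `det H = det H' · z σ(z)` for some `z ∈ L^×` (equality of the discriminants in `L₀^× / N_{L/L₀}(L^×)`). [cite: Landherr1936HermitianForms] -/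
theorem hermitianMatrices_congruent_iff_invariants (L : Type) [Field L] [NumberField L] [IsCMField L] {ι : Type} [Fintype ι] [DecidableEq ι] (H H' : Matrix ι ι L)
    (hH : H.transpose.map (IsCMField.complexConj L) = H) (hH' : H'.transpose.map (IsCMField.complexConj L) = H')
    (h0 : H.det ≠ 0) (h0' : H'.det ≠ 0) :
    (∃ g : GL ι L, ((g : Matrix ι ι L).transpose.map (IsCMField.complexConj L)) * H * (g : Matrix ι ι L) = H') ↔
      ((∀ τ : L →+* ℂ,
          (Finset.univ.filter fun i => 0 < (isHermitian_map L hH τ).eigenvalues i).card =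
            (Finset.univ.filter fun i => 0 < (isHermitian_map L hH' τ).eigenvalues i).card) ∧
        ∃ z : L, z ≠ 0 ∧ H.det = H'.det * (z * IsCMField.complexConj L z)) := by
  obtain ⟨G, hG, d, hd, hd0, e⟩ := exists_congr_diagonal L H hH h0
  obtain ⟨G', hG', d', hd', hd'0, e'⟩ := exists_congr_diagonal L H' hH' h0'
  refine (congr_iff_isomDiag L hG e hG' e').trans ?_
  have key : IsomDiag L d d' ↔
      ((∀ τ : L →+* ℂ, (Finset.univ.filter fun i => 0 < (τ (d i)).re).card =
          (Finset.univ.filter fun i => 0 < (τ (d' i)).re).card) ∧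
        ∃ z : L, z ≠ 0 ∧ ∏ i, d i = (∏ i, d' i) * (z * IsCMField.complexConj L z)) :=
    ⟨fun h => (hermitianDiagonal_isometric_iff_invariants L d d' hd hd' hd0 hd'0).mp h.exists_gl,
     fun h => by
      obtain ⟨g, hg⟩ := (hermitianDiagonal_isometric_iff_invariants L d d' hd hd' hd0 hd'0).mpr h
      exact IsomDiag.of_gl g hg⟩
  refine key.trans (and_congr (forall_congr' fun τ => ?_) ?_)
  · rw [card_pos_eigenvalues_eq_posCount L hH hG e τ, card_pos_eigenvalues_eq_posCount L hH' hG' e' τ]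
    rfl
  · rw [prod_eq_det_mul_norm L e, prod_eq_det_mul_norm L e']
    exact normClass_mul_norm_iff L hG.ne_zero hG'.ne_zero

/-- The rank-`n` matrix form over `Fin n`. [cite: Landherr1936HermitianForms] -/
theorem hermitianMatrices_congruent_iff_invariants_fin (L : Type) [Field L] [NumberField L] [IsCMField L] (n : ℕ) (H H' : Matrix (Fin n) (Fin n) L)
    (hH : H.transpose.map (IsCMField.complexConj L) = H) (hH' : H'.transpose.map (IsCMField.complexConj L) = H')
    (h0 : H.det ≠ 0) (h0' : H'.det ≠ 0) :
    (∃ g : GL (Fin n) L, ((g : Matrix (Fin n) (Fin n) L).transpose.map (IsCMField.complexConj L)) * H *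
        (g : Matrix (Fin n) (Fin n) L) = H') ↔
      ((∀ τ : L →+* ℂ,
          (Finset.univ.filter fun i => 0 < (Landherr.isHermitian_map L hH τ).eigenvalues i).card =
            (Finset.univ.filter fun i => 0 < (Landherr.isHermitian_map L hH' τ).eigenvalues i).card) ∧
        ∃ z : L, z ≠ 0 ∧ H.det = H'.det * (z * IsCMField.complexConj L z)) :=
  hermitianMatrices_congruent_iff_invariants L H H' hH hH' h0 h0'

/-- **Diagonalisability**, root-level form: every non-degenerate `σ`-hermitian matrix over a CM field is
`ᵗ(σg) · H · g = diag d` for some `g ∈ GL(L)` and `d` with `σ`-fixed non-zero entries. [cite: Landherr1936HermitianForms] -/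
theorem hermitianMatrix_congruent_diagonal (L : Type) [Field L] [NumberField L] [IsCMField L] {ι : Type} [Fintype ι] [DecidableEq ι] (H : Matrix ι ι L)
    (hH : H.transpose.map (IsCMField.complexConj L) = H) (h0 : H.det ≠ 0) :
    ∃ g : GL ι L, ∃ d : ι → L, (∀ i, IsCMField.complexConj L (d i) = d i) ∧ (∀ i, d i ≠ 0) ∧
      ((g : Matrix ι ι L).transpose.map (IsCMField.complexConj L)) * H * (g : Matrix ι ι L) = Matrix.diagonal d := by
  obtain ⟨G, hG, d, hd, hd0, e⟩ := Landherr.exists_congr_diagonal L H hH h0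
  exact ⟨Matrix.nonsingInvUnit G hG, d, hd, hd0, e⟩


end Literature.NumberTheory.QuadraticForms

end
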